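import Literature.Barriers.ValiantsHypothesis.NotViaSaturationsChowProofs
import Literature.Computability.AlgebraicComplexity.PlethysmStability
import HarnessLib

/-!
# Not via saturations — BHI's Theorem 3 through the normalisation of the Chow variety
# (BHI 2017, §2 Prop. 1, §3 Lemmas 4–6, Props. 2–3): the finer decomposition

Third file of the vendoring of P. Bürgisser, J. Hüttenhain, C. Ikenmeyer, *Permanent versus
determinant: not via saturations*, Proc. AMS 145 (2017) = arXiv:1501.05528 (barrier
`NotViaSaturations` = `BHI2017_thm1`). `NotViaSaturationsChow.lean` reduced Theorem 1 to
`S(Chow_n) ⊆ S(Det_n)` (discharged in `NotViaSaturationsChowProofs.lean`) and Theorem 3, itself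
reduced to Props. 2 and 3 (named facts `BHI2017_prop2`, `BHI2017_prop3`). This file opens Props. 2
and 3 along the printed proofs, whose common black box is the NORMALISATION of the Chow variety:

* §3 (pp. 6–7 of the held text): the normalisation of `Chow_n` is `ψ_n : V^n//H_n → Chow_n`
  (Lemma 3, Brion), and **Lemma 4.** "`S(V^n//H_n) = {λ ∈ Λ⁺_G(poly) | n divides |λ| and V_G(λ)`
  `occurs in Sym^n Sym^{|λ|/n} ℂ^n}`." With **Prop. 1** (§2: "We have `A(S(Z̃)) = A(S(Z))` and
  `Sat(S(Z̃)) = Sat(S(Z))`", proved through `C_ℚ(S(Z)) = C_ℚ(S(Z̃))`) this gives the two sentences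
  actually used: "According to Proposition 1, the semigroups `S(Chow_n)` and `S(V^n//H_n)` generate
  the same rational cone" (proof of Prop. 2) and "Proposition 1 tells us that `A` equals the group
  generated by the monoid `S(V^n//H_n)`" (before Lemma 5). These are the named facts
  `BHI2017_prop1_cone` and `BHI2017_prop1_group` below, with `S(V^n//H_n)` replaced by its Lemma-4
  description `normChowWeights n`.
* Prop. 2 then rests on "[bci:10] ... `V_{Gl_n}(2λ)` occurs in `Sym^nSym^{2k}(ℂ^n)`" — the theorem
  of Bürgisser–Christandl–Ikenmeyer, *Even partitions in plethysms*, J. Algebra 328 (2011):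
  "For all `k,n,d ∈ ℕ` with `k ≤ d` and for all partitions `λ` of size `kn` with at most `k` parts,
  the irreducible `GL_d`-representation `{2λ}` of highest weight `2λ` occurs in the plethysm
  `Sym^k(Sym^{2n}ℂ^d)`" (named fact `BCI2011_evenPlethysm`); the degree bound `N < n^{n²-2n}` of
  Prop. 2 (Noether normalisation, Cohen–Macaulayness) is not needed for Theorem 3 and is not
  opened here.
* Prop. 3 rests on **Lemma 5** ("If `λ` occurs in `Sym^nSym^kV`, `ℓ ∈ ℕ`, then `(1 × ℓk) + λ`
  occurs in `Sym^{ℓ+n}Sym^kV`" — PROVED here, `add_single_zero_mem_symSymOcc`: product with the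
  `ℓ`-th power of the highest-weight vector of `Sym^k V`), the two plethysm checks "`(2,2,0…,0)`
  occurs in `Sym^2Sym^2V` and `(6,3,0,…,0)` occurs in `Sym^3Sym^3V`" (PROVED in the sibling proof
  file by the classical seminvariants of binary quadrics and cubics), and **Lemma 6** ("Let
  `n ≥ k ≥ 2`, `d := k(k-1)/2`, and the partition `μ` of size `k²` be obtained by appending to
  `2 × d` a column of length `k`. Further, let `λ` denote the partition of size `nk` obtained by
  appending to `μ` a row of length `(n-k)k`. Then the partition `λ` occurs in `Sym^n Sym^k V`";
  named fact `BHI2017_lemma6`, in print via inheritance and Manivel–Michałek Cor. 6.4).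

**Rendering.** "`V(λ)` occurs in `Sym^d Sym^k ℂ^n`" is, in the convention of the whole topic
(coordinate rings carry the DUAL weights, BLMW (5.2.2); tree: `orbitMultiplicity_le_plethysmCoeff`,
`hasHighestWeight_coordRep_of_orbitCoordRep`), a nonzero highest-weight vector of weight `λ^*` in
`ℂ[Sym^k ℂ^n] = ⊕_d Sym^d(Sym^k ℂ^n)^*` (tree: `coordRep (Fin n) ℂ k`), the outer degree `d` being
pinned by `|λ| = dk`: the set `symSymOcc n k`. Lemma 4's monoid is `normChowWeights n`
(`n ∣ |λ|` and `λ ∈ symSymOcc n (|λ|/n)`, outer degree `n` automatic). Lemma 6's partition is the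
weight `lemma6Weight n k`; the two-row weights `(a, b, 0, …, 0)` are `twoRowWeight n a b`.

**What is here.** The definitions; the four named facts; PROVED: Lemma 5 (from the tree's
`mul_mem_highestWeightSpace_coordRep` / `pow_mem_highestWeightSpace_coordRep` of
`PlethysmStability.lean`), the sizes and coordinates of the weights involved. The sibling `NotViaSaturationsChowNormalProofs.lean`
proves the plethysm checks and assembles: `BHI2017_prop3` from `BHI2017_prop1_group` and
`BHI2017_lemma6`; the cone half of Prop. 2 from `BHI2017_prop1_cone` and `BCI2011_evenPlethysm`;
hence `BHI2017_thm3` and `BHI2017_thm1` from these four facts.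

## References

* [BurgisserHuttenhainIkenmeyer2017] BHI, Proc. AMS 145 (2017) = arXiv:1501.05528: §2 Prop. 1,
  §3 Lemma 3, Lemma 4, Prop. 2 (and its proof), Lemma 5, Lemma 6, Prop. 3 (and its proof).
* [BurgisserChristandlIkenmeyer2011Even] P. Bürgisser, M. Christandl, C. Ikenmeyer, *Even
  partitions in plethysms*, J. Algebra 328 (2011) 322–329 = arXiv:1003.4474, Theorem (§1.1).
* [BurgisserEtAl2011] BLMW 2011, §4.4, (5.2.2) (dual weights of coordinate rings).
-/

noncomputable section

open MvPolynomial

namespace Literature.Barriers.ValiantsHypothesis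

open Literature.NumberTheory.DiophantineGeometry Literature.Computability.AlgebraicComplexity
  Literature.Computability.Complexity

/-! ### Occurrence in the plethysms `Sym^d Sym^k ℂ^n` -/

/-- **"`V(χ)` occurs in `⊕_d Sym^d(Sym^k ℂ^n)`"** (for `|χ| = dk`: "`V(χ)` occurs in the plethysm
`Sym^d(Sym^k ℂ^n)`"): the dual weight `χ^*` has a nonzero highest-weight vector in the coordinate
ring `ℂ[Sym^k ℂ^n] = ⊕_d Sym^d(Sym^k ℂ^n)^*` (tree: `coordRep (Fin n) ℂ k`, upper triangular Borel),
the outer degree `d` being pinned by the size of the weight. BHI §3 ("We say that `λ` occurs in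
`Sym^nSym^kV` if `V_G(λ)` occurs as a submodule in the latter"); convention of BLMW (5.2.2).
[cite: BurgisserHuttenhainIkenmeyer2017, §3 (before Lemma 5)] -/
def symSymOcc (n k : ℕ) : Set (Weight (Fin n)) :=
  {χ | HasHighestWeight (coordRep (Fin n) ℂ k) χ.dual}

/-- Membership in `symSymOcc`, unfolded. [cite: BurgisserHuttenhainIkenmeyer2017, §3] -/
theorem mem_symSymOcc_iff (n k : ℕ) (χ : Weight (Fin n)) :
    χ ∈ symSymOcc n k ↔ HasHighestWeight (coordRep (Fin n) ℂ k) χ.dual :=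
  Iff.rfl

/-- **The monoid of representations of the normalisation `V^n//H_n` of the Chow variety**
(BHI Lemma 4): "`S(V^n//H_n) = {λ ∈ Λ⁺_G(poly) | n divides |λ| and V_G(λ) occurs in`
`Sym^nSym^{|λ|/n}ℂ^n}`", as a set of weights of `GL_n` (for `λ ∈ symSymOcc n (|λ|/n)` with
`n ∣ |λ|` the outer degree is `|λ|/(|λ|/n) = n`, so this is occurrence in `Sym^n Sym^{|λ|/n} ℂ^n`;
polynomiality is automatic for occurring weights). [cite: BurgisserHuttenhainIkenmeyer2017, Lemma 4] -/
def normChowWeights (n : ℕ) : Set (Weight (Fin n)) :=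
  {χ | (n : ℤ) ∣ χ.size ∧ χ ∈ symSymOcc n (χ.size.toNat / n)}

/-- Membership in `normChowWeights`, unfolded. [cite: BurgisserHuttenhainIkenmeyer2017, Lemma 4] -/
theorem mem_normChowWeights_iff (n : ℕ) (χ : Weight (Fin n)) :
    χ ∈ normChowWeights n ↔ (n : ℤ) ∣ χ.size ∧ χ ∈ symSymOcc n (χ.size.toNat / n) :=
  Iff.rfl

/-- A weight of size `n k` occurring in `⊕_d Sym^d Sym^k ℂ^n` (i.e. in `Sym^n Sym^k ℂ^n`) lies in
`S(V^n//H_n)`. [cite: BurgisserHuttenhainIkenmeyer2017, Lemma 4] -/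
theorem mem_normChowWeights_of_size {n k : ℕ} (hn : 0 < n) {χ : Weight (Fin n)}
    (hχ : χ ∈ symSymOcc n k) (hsize : χ.size = ((n * k : ℕ) : ℤ)) : χ ∈ normChowWeights n := by
  refine ⟨⟨k, by rw [hsize]; push_cast; ring⟩, ?_⟩
  rwa [hsize, Int.toNat_natCast, Nat.mul_div_cancel_left k hn]

/-! ### Two-row weights and the partitions of Lemma 6 -/

/-- The weight `(a, b, 0, …, 0) ∈ ℤ^n` (a partition with at most two rows when `a ≥ b ≥ 0`).
[folklore] -/
def twoRowWeight (n : ℕ) (a b : ℤ) : Weight (Fin n) :=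
  fun i => if (i : ℕ) = 0 then a else if (i : ℕ) = 1 then b else 0

/-- Unfolding of `twoRowWeight`. [folklore] -/
theorem twoRowWeight_apply (n : ℕ) (a b : ℤ) (i : Fin n) :
    twoRowWeight n a b i = if (i : ℕ) = 0 then a else if (i : ℕ) = 1 then b else 0 :=
  rfl

/-- `twoRowWeight` is additive in `(a, b)`. [folklore] -/
theorem twoRowWeight_add (n : ℕ) (a b a' b' : ℤ) :
    twoRowWeight n (a + a') (b + b') = twoRowWeight n a b + twoRowWeight n a' b' := by
  funext i
  simp only [twoRowWeight_apply, Pi.add_apply]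
  split_ifs <;> ring

/-- `twoRowWeight` is subtractive in `(a, b)`. [folklore] -/
theorem twoRowWeight_sub (n : ℕ) (a b a' b' : ℤ) :
    twoRowWeight n (a - a') (b - b') = twoRowWeight n a b - twoRowWeight n a' b' := by
  funext i
  simp only [twoRowWeight_apply, Pi.sub_apply]
  split_ifs <;> ring

/-- For `n ≥ 2`, `(a, b, 0, …, 0) = a ε_0 + b ε_1`. [folklore] -/
theorem twoRowWeight_eq_single_add_single {n : ℕ} (hn : 2 ≤ n) (a b : ℤ) :
    twoRowWeight n a b = Pi.single (⟨0, by omega⟩ : Fin n) a + Pi.single (⟨1, by omega⟩ : Fin n) b := by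
  funext i
  rw [twoRowWeight_apply, Pi.add_apply]
  by_cases h0 : (i : ℕ) = 0
  · have hi : i = ⟨0, by omega⟩ := Fin.ext h0
    rw [if_pos h0, hi, Pi.single_eq_same, Pi.single_eq_of_ne, add_zero]
    exact fun h => absurd (congrArg Fin.val h) (by norm_num)
  · rw [if_neg h0, Pi.single_eq_of_ne (fun h => h0 (by rw [h])), zero_add]
    by_cases h1 : (i : ℕ) = 1
    · have hi : i = ⟨1, by omega⟩ := Fin.ext h1
      rw [if_pos h1, hi, Pi.single_eq_same]
    · rw [if_neg h1, Pi.single_eq_of_ne (fun h => h1 (by rw [h]))]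

/-- The size of `(a, b, 0, …, 0)` is `a + b` (`n ≥ 2`). [folklore] -/
theorem size_twoRowWeight {n : ℕ} (hn : 2 ≤ n) (a b : ℤ) : (twoRowWeight n a b).size = a + b := by
  rw [twoRowWeight_eq_single_add_single hn, Weight.size]
  simp only [Pi.add_apply]
  rw [Finset.sum_add_distrib, Finset.sum_pi_single', Finset.sum_pi_single',
    if_pos (Finset.mem_univ _), if_pos (Finset.mem_univ _)]

/-- Adding `c ε_0` to a two-row weight. [folklore] -/
theorem twoRowWeight_add_single {n : ℕ} (hn : 2 ≤ n) (a b c : ℤ) :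
    twoRowWeight n a b + Pi.single (⟨0, by omega⟩ : Fin n) c = twoRowWeight n (a + c) b := by
  rw [twoRowWeight_eq_single_add_single hn, twoRowWeight_eq_single_add_single hn, Pi.single_add]
  abel

/-- The column part `(0, 0, 1, …, 1, 0, …, 0)` (ones in rows `2, …, K-1`) of Lemma 6's partition.
[cite: BurgisserHuttenhainIkenmeyer2017, Lemma 6] -/
def columnTailWeight (n K : ℕ) : Weight (Fin n) :=
  fun i => if 2 ≤ (i : ℕ) ∧ (i : ℕ) < K then 1 else 0

/-- Unfolding of `columnTailWeight`. [cite: BurgisserHuttenhainIkenmeyer2017, Lemma 6] -/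
theorem columnTailWeight_apply (n K : ℕ) (i : Fin n) :
    columnTailWeight n K i = if 2 ≤ (i : ℕ) ∧ (i : ℕ) < K then 1 else 0 :=
  rfl

/-- The size of the column part is `K - 2` (`K ≤ n`). [folklore] -/
theorem size_columnTailWeight {n K : ℕ} (hK : K ≤ n) :
    (columnTailWeight n K).size = ((K - 2 : ℕ) : ℤ) := by
  rw [Weight.size]
  simp only [columnTailWeight_apply]
  rw [Finset.sum_boole]
  congr 1
  have : (Finset.univ.filter fun i : Fin n => 2 ≤ (i : ℕ) ∧ (i : ℕ) < K) =
      (Finset.Ico 2 K).attachFin fun i hi => by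
        rw [Finset.mem_Ico] at hi; omega := by
    ext i
    simp only [Finset.mem_filter, Finset.mem_univ, true_and, Finset.mem_attachFin, Finset.mem_Ico]
  rw [this, Finset.card_attachFin, Nat.card_Ico]

/-- **The partition `λ = λ^{(k)}` of BHI Lemma 6** as a weight of `GL_n`: "`d := k(k-1)/2`, and
the partition `μ` of size `k²` be obtained by appending to `2 × d` a column of length `k`" —
`μ = (d+1, d+1, 1^{k-2})` — "let `λ` denote the partition of size `nk` obtained by appending to `μ`
a row of length `(n-k)k`": `λ = ((n-k)k + d + 1, d + 1, 1^{k-2}, 0^{n-k})`. (Meaningful for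
`2 ≤ k ≤ n`.) [cite: BurgisserHuttenhainIkenmeyer2017, Lemma 6] -/
def lemma6Weight (n K : ℕ) : Weight (Fin n) :=
  twoRowWeight n (((n - K) * K + K * (K - 1) / 2 + 1 : ℕ) : ℤ) ((K * (K - 1) / 2 + 1 : ℕ) : ℤ) +
    columnTailWeight n K

/-- The size of Lemma 6's partition is `n k` ("the partition of size `nk`").
[cite: BurgisserHuttenhainIkenmeyer2017, Lemma 6] -/
theorem size_lemma6Weight {n K : ℕ} (h2 : 2 ≤ K) (hK : K ≤ n) :
    (lemma6Weight n K).size = ((n * K : ℕ) : ℤ) := by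
  have hsize : (lemma6Weight n K).size = (twoRowWeight n (((n - K) * K + K * (K - 1) / 2 + 1 : ℕ) : ℤ)
      ((K * (K - 1) / 2 + 1 : ℕ) : ℤ)).size + (columnTailWeight n K).size := by
    simp only [Weight.size, lemma6Weight, Pi.add_apply, Finset.sum_add_distrib]
  rw [hsize, size_twoRowWeight (le_trans h2 hK), size_columnTailWeight hK]
  have hd : 2 * (K * (K - 1) / 2) = K * (K - 1) := Nat.two_mul_div_two_of_even (Nat.even_mul_pred_self K)
  have hK' : (n - K) * K + K * (K - 1) + K = n * K := by
    zify [hK, (by omega : 1 ≤ K)]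
    ring
  push_cast [h2]
  zify at hd hK'
  linarith

/-- The coordinates of Lemma 6's partition beyond the second row: `λ_i = 1` for `2 ≤ i < k` and
`λ_i = 0` for `i ≥ k` ("we have `λ^{(k)}_k = 1` and `λ^{(k)}_i = 0` for `i > k`", 1-based).
[cite: BurgisserHuttenhainIkenmeyer2017, Prop. 3 (proof)] -/
theorem lemma6Weight_apply_of_two_le {n K : ℕ} (i : Fin n) (hi : 2 ≤ (i : ℕ)) :
    lemma6Weight n K i = if (i : ℕ) < K then 1 else 0 := by
  rw [lemma6Weight, Pi.add_apply, twoRowWeight_apply, columnTailWeight_apply, if_neg (by omega),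
    if_neg (by omega), zero_add]
  by_cases h : (i : ℕ) < K
  · rw [if_pos ⟨hi, h⟩, if_pos h]
  · rw [if_neg (fun h' => h h'.2), if_neg h]

/-! ### The printed ingredients of Props. 2 and 3 as named facts (D-0014) -/

/-- **BHI Prop. 1 for the Chow variety, group part** ("Proposition 1 tells us that `A` equals the
group generated by the monoid `S(V^n//H_n)`", with Lemma 3 (Brion: `ψ_n : V^n//H_n → Chow_n` is
the normalisation) and Lemma 4 (the description of `S(V^n//H_n)`)): the group generated by
`S(Chow_n)` is the group generated by `S(V^n//H_n)`. Prop. 1 in print: "We have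
`A(S(Z̃)) = A(S(Z))`" for the normalisation `Z̃ → Z` of a closed `G`-stable `Z` (Lemma 1:
`Frac(𝒪(Z)^U) = ℂ(Z)^U`). [cite: BurgisserHuttenhainIkenmeyer2017, Prop. 1 with Lemmas 3–4 (§3, before Lemma 5)] -/
def BHI2017_prop1_group : Prop :=
  ∀ n : ℕ, 0 < n →
    AddSubgroup.closure (chowOccWeights n : Set (Weight (Fin n))) =
      AddSubgroup.closure (normChowWeights n)

/-- **BHI Prop. 1 for the Chow variety, cone part** ("According to Proposition 1, the semigroups
`S(Chow_n)` and `S(V^n//H_n)` generate the same rational cone", proof of Prop. 2; Prop. 1 in print: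
"`Sat(S(Z̃)) = Sat(S(Z))` ... it suffices to prove that `C_ℚ(S(Z)) = C_ℚ(S(Z̃))`", by the minimal
polynomial of an integral highest-weight vector), with `C_ℚ(S) = {x | ∃ k > 0, kx ∈ S}` ((5) and
`ratCone`) and `S(V^n//H_n) = normChowWeights n` (Lemma 4).
[cite: BurgisserHuttenhainIkenmeyer2017, Prop. 1 with Lemmas 3–4 (proof of Prop. 2)] -/
def BHI2017_prop1_cone : Prop :=
  ∀ n : ℕ, 0 < n → ∀ χ : Weight (Fin n),
    χ ∈ ratCone (chowOccWeights n) ↔ ∃ k : ℕ, 0 < k ∧ k • χ ∈ normChowWeights n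

/-- **Bürgisser–Christandl–Ikenmeyer, *Even partitions in plethysms* (Weintraub's conjecture),
Theorem.** "For all `k,n,d ∈ ℕ` with `k ≤ d` and for all partitions `λ` of size `kn` with at most
`k` parts, the irreducible `GL_d`-representation `{2λ}` of highest weight `2λ` occurs in the
plethysm `Sym^k(Sym^{2n}ℂ^d)`." Weight form: `λ` = a polynomial weight `χ` of `GL_d` of size `kn`
with `χ_i = 0` for `i ≥ k`; occurrence of `{2χ}` in `Sym^k(Sym^{2n}ℂ^d)` = `2χ ∈ symSymOcc d (2n)`
(outer degree `k` pinned by `|2χ| = k · 2n`). (BHI: "In [bci:10] ... it was shown that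
`V_{Gl_n}(2λ)` occurs in `Sym^nSym^{2k}(ℂ^n)`", the case `(k,n,d) = (n,k,n)`.)
[cite: BurgisserChristandlIkenmeyer2011Even, Theorem (§1.1)] -/
def BCI2011_evenPlethysm : Prop :=
  ∀ (k n d : ℕ), k ≤ d → ∀ χ : Weight (Fin d), χ.IsPolynomial → χ.size = ((k * n : ℕ) : ℤ) →
    (∀ i : Fin d, k ≤ (i : ℕ) → χ i = 0) → (2 • χ) ∈ symSymOcc d (2 * n)

/-- **BHI Lemma 6.** "Let `n ≥ k ≥ 2`, `d := k(k-1)/2`, and the partition `μ` of size `k²` be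
obtained by appending to `2 × d` a column of length `k`. Further, let `λ` denote the partition of
size `nk` obtained by appending to `μ` a row of length `(n-k)k`. Then the partition `λ` occurs in
`Sym^n Sym^k V`" (`V = ℂ^n`; proof in print: `2 × d` occurs in `Λ^kSym^{k-1}ℂ²` (an
`SL_2`-invariant), inheritance, Manivel–Michałek Cor. 6.4, Lemma 5). With
`λ = lemma6Weight n k` (size `nk`, so the outer degree is `n`).
[cite: BurgisserHuttenhainIkenmeyer2017, Lemma 6] -/
def BHI2017_lemma6 : Prop :=
  ∀ (n K : ℕ), 2 ≤ K → K ≤ n → lemma6Weight n K ∈ symSymOcc n K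

/-! ### Lemma 5 -/

/-- The dual of `c ε_0 ∈ ℤ^n` is `-c ε_{n-1}`. [folklore] -/
theorem _root_.Literature.NumberTheory.DiophantineGeometry.Weight.dual_single_zero {n : ℕ}
    (hn : 0 < n) (c : ℤ) :
    Weight.dual (Pi.single (⟨0, hn⟩ : Fin n) c) = Pi.single (Fin.rev ⟨0, hn⟩) (-c) := by
  funext i
  simp only [Weight.dual]
  by_cases hi : i = Fin.rev ⟨0, hn⟩
  · rw [hi, Pi.single_eq_same, Fin.rev_rev, Pi.single_eq_same]
  · rw [Pi.single_eq_of_ne hi, Pi.single_eq_of_ne, neg_zero]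
    intro h
    apply hi
    rw [← h, Fin.rev_rev]

/-- **BHI Lemma 5.** "If `λ` occurs in `Sym^nSym^kV`, `ℓ ∈ ℕ`, then `(1 × ℓk) + λ` occurs in
`Sym^{ℓ+n}Sym^kV`." In the set `symSymOcc n k` (all outer degrees at once): if `χ ∈ symSymOcc n k`
then `χ + ℓk·ε_0 ∈ symSymOcc n k` — the highest-weight vector of `χ^*` times the `ℓ`-th power of
the coordinate function of `x_{n-1}^k` (the highest-weight vector `v^{⊗ℓk}`, weight `-ℓk ε_{n-1}`)
is a nonzero highest-weight vector of weight `(χ + ℓk ε_0)^*`.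
[cite: BurgisserHuttenhainIkenmeyer2017, Lemma 5] -/
theorem add_single_zero_mem_symSymOcc {n k : ℕ} (hn : 0 < n) {χ : Weight (Fin n)}
    (hχ : χ ∈ symSymOcc n k) (ℓ : ℕ) :
    χ + Pi.single (⟨0, hn⟩ : Fin n) ((ℓ * k : ℕ) : ℤ) ∈ symSymOcc n k := by
  classical
  rw [mem_symSymOcc_iff] at hχ ⊢
  obtain ⟨F, hF0, hF⟩ := (hasHighestWeight_iff_exists _ _).mp hχ
  set iₘ : Fin n := Fin.rev ⟨0, hn⟩ with hiₘ
  have htop : ∀ i : Fin n, i ≤ iₘ := fun i => by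
    rw [hiₘ, Fin.le_rev_iff]
    exact Fin.mk_le_of_le_val (Nat.zero_le _)
  set d : DegIdx (Fin n) k := ⟨Finsupp.single iₘ k, by
    rw [mem_degMonomials_iff, Finsupp.degree_single]⟩ with hd
  have hG := X_mem_highestWeightSpace_coordRep (k := ℂ) k iₘ htop d rfl
  have hFG := mul_mem_highestWeightSpace_coordRep hF (pow_mem_highestWeightSpace_coordRep hG ℓ)
  rw [hasHighestWeight_iff_exists]
  refine ⟨F * X d ^ ℓ, mul_ne_zero hF0 (pow_ne_zero _ (X_ne_zero d)), ?_⟩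
  have hw : (χ + Pi.single (⟨0, hn⟩ : Fin n) ((ℓ * k : ℕ) : ℤ)).dual =
      χ.dual + ℓ • Pi.single iₘ (-(k : ℤ)) := by
    rw [Weight.dual_add, Weight.dual_single_zero hn, ← Pi.single_smul, smul_neg, nsmul_eq_mul,
      Nat.cast_mul]
  rw [hw]
  exact hFG

/-- Lemma 5 for two-row weights: `(a, b, 0, …) ∈ symSymOcc n k` gives `(a + ℓk, b, 0, …) ∈
symSymOcc n k` (`n ≥ 2`). [cite: BurgisserHuttenhainIkenmeyer2017, Lemma 5] -/
theorem twoRowWeight_add_mem_symSymOcc {n k : ℕ} (hn : 2 ≤ n) {a b : ℤ}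
    (h : twoRowWeight n a b ∈ symSymOcc n k) (ℓ : ℕ) :
    twoRowWeight n (a + (ℓ * k : ℕ)) b ∈ symSymOcc n k := by
  rw [← twoRowWeight_add_single hn]
  exact add_single_zero_mem_symSymOcc (by omega) h ℓ

end Literature.Barriers.ValiantsHypothesis
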